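import Literature.Computability.QuantumComplexity.ZXCalculusControlAlpha
import HarnessLib

/-!
# ZX-calculus: JPV LICS 2019, Lemma `2-cycle-triangle-with-one-not`

`Z^{(1,2)} ⨾ ((X(π) ⨾ T) ⊗ Tᵗ) ⨾ Z^{(2,1)} = 1/√2 ⊗ (X^{(1,0)} ⨾ Z^{(0,1)})`, following the printed proof
(looped triangle, swappable outputs of the fork, the two-triangle cycle, Hopf). [cite: JeandelPerdrixVilmart2018, §6; JPV LICS 2019 Appendix]
-/

namespace Literature.Computability.QuantumComplexity

open ZXDiagram

namespace ZXClass

/-- `Tᵗ ⨾ X(π) = √2 ⊗ (Z^{(1,2)} ⨾ (Tᵗ ⊗ 𝕀) ⨾ X^{(2,1)})` (the looped triangle, conjugated by `X(π)`).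
[cite: JeandelPerdrixVilmart2018, Appendix Lemma 29] -/
theorem triangleT_seq_X_pi_eq_loop :
    (mk triangle).transpose ⨟ mk (X 1 1 4) = mk (dumbbell 0 0) ⊠ (mk (Z 1 2 0) ⨟ ((mk triangle).transpose ⊠ mk (wires 1)) ⨟ mk (X 2 1 0)) := by
  have hXX : (mk (X 1 1 4) ⊠ mk (X 1 1 4)) ⨟ mk (X 2 1 0) = mk (X 2 1 0) := by
    rw [par_eq_seq_left (mk (X 1 1 4)) (mk (X 1 1 4)), seq_assoc, par_X_seq_X 1 1 1 1 le_rfl, zero_add, X_par_seq_X 1 1 1 1 le_rfl,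
      show (4 : ZMod 8) + 4 = 0 from by decide]
  rw [← X_pi_seq_triangle]
  nth_rewrite 1 [← looped_triangle]
  rw [seq_scalar_par_one', ← seq_assoc, ← seq_assoc, K1_red, seq_assoc _ (mk (X 1 1 4) ⊠ mk (X 1 1 4)),
    interchange, X_pi_seq_triangle, show ((mk triangle).transpose ⨟ mk (X 1 1 4)) ⊠ (mk (X 1 1 4) ⨟ mk (wires 1)) = ((mk triangle).transpose ⊠ mk (wires 1)) ⨟ (mk (X 1 1 4) ⊠ mk (X 1 1 4)) from by
      rw [interchange, id_seq, seq_id], seq_assoc, seq_assoc, hXX, ← seq_assoc]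
  where
  seq_scalar_par_one' (A : ZXClass 1 1) (s : ZXClass 0 0) (B : ZXClass 1 1) : A ⨟ (s ⊠ B) = s ⊠ (A ⨟ B) := by
    rw [scalar_par_seq_right, empty_par, cast_id]

/-- `Z^{(1,2)} ⨾ X^{(2,1)} = (1/√2)² ⊗ (Z^{(1,0)} ⨾ X^{(0,1)})` (Hopf). [cite: JeandelPerdrixVilmart2018, Fig. 1 (B1), (IV)] -/
theorem split_seq_xmerge_eq_disconnect : mk (Z 1 2 0) ⨟ mk (X 2 1 0) = mk invSqrtTwo ⊠ (mk invSqrtTwo ⊠ (mk (Z 1 0 0) ⨟ mk (X 0 1 0))) := by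
  have h := congrArg transpose hopf
  have h' : mk (dumbbell 0 0) ⊠ (mk (dumbbell 0 0) ⊠ (mk (Z 1 2 0) ⨟ mk (X 2 1 0))) = mk (Z 1 0 0) ⨟ mk (X 0 1 0) := by simpa using h
  have h'' := congrArg (fun Y => mk invSqrtTwo ⊠ (mk invSqrtTwo ⊠ Y)) h'
  rw [scalar_par_scalar_par (mk invSqrtTwo) (mk (dumbbell 0 0)), invSqrtTwo_par_sqrt_two_par_one, invSqrtTwo_par_sqrt_two_par_one] at h''
  exact h''

/-- **JPV LICS 2019, Lemma `2-cycle-triangle-with-one-not` (transposed form)**: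
`Z^{(1,2)} ⨾ ((Tᵗ ⨾ X(π)) ⊗ T) ⨾ Z^{(2,1)} = 1/√2 ⊗ (Z^{(1,0)} ⨾ X^{(0,1)})`. [cite: JeandelPerdrixVilmart2018, §6; JPV LICS 2019 Appendix] -/
theorem split_triangleT_X_pi_par_triangle_merge :
    mk (Z 1 2 0) ⨟ (((mk triangle).transpose ⨟ mk (X 1 1 4)) ⊠ mk triangle) ⨟ mk (Z 2 1 0) = mk invSqrtTwo ⊠ (mk (Z 1 0 0) ⨟ mk (X 0 1 0)) := by
  have hbend : (mk (wires 1) ⊠ mk (Z 1 2 0)) ⨟ (mk cap ⊠ mk (wires 1)) = mk (Z 2 1 0) := by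
    have h := congrArg colorSwap par_xsplit_seq_cap_par
    simpa using h
  have hX30a : (mk (X 2 1 0) ⊠ mk (wires 1)) ⨟ mk cap = mk (X 3 0 0) := by
    have h := congrArg colorSwap Z_three_zero_eq_merge_par_cap
    simp at h; exact h.symm
  have hX30b : (mk (wires 1) ⊠ mk (X 2 1 0)) ⨟ mk cap = mk (X 3 0 0) := by
    have h := congrArg colorSwap Z_three_zero_eq_par_merge_cap
    simp at h; exact h.symm
  -- Step 1: the looped triangle
  have h1 : mk (Z 1 2 0) ⨟ (((mk triangle).transpose ⨟ mk (X 1 1 4)) ⊠ mk triangle) ⨟ mk (Z 2 1 0) =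
      mk (dumbbell 0 0) ⊠ (mk (Z 1 3 0) ⨟ (((mk triangle).transpose ⊠ mk (wires 1)) ⊠ mk triangle) ⨟ (mk (X 2 1 0) ⊠ mk (wires 1)) ⨟ mk (Z 2 1 0)) := by
    rw [triangleT_seq_X_pi_eq_loop, scalar_par_one_par_one, one_two_seq_scalar_par_two'', scalar_par_one_two_seq_one,
      show (mk (Z 1 2 0) ⨟ ((mk triangle).transpose ⊠ mk (wires 1)) ⨟ mk (X 2 1 0)) ⊠ mk triangle =
        (mk (Z 1 2 0) ⊠ mk (wires 1)) ⨟ (((mk triangle).transpose ⊠ mk (wires 1)) ⊠ mk triangle) ⨟ (mk (X 2 1 0) ⊠ mk (wires 1)) from by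
          rw [interchange, id_seq, interchange, seq_id],
      ← seq_assoc (mk (Z 1 2 0)), ← seq_assoc (mk (Z 1 2 0)), Z_seq_Z_par 1 1 1 2 le_rfl, add_zero]
  -- Step 2: the fork, with its red output fed back through `Tᵗ`
  have hM : mk (Z 1 3 0) ⨟ (((mk triangle).transpose ⊠ mk (wires 1)) ⊠ mk triangle) ⨟ (mk (X 2 1 0) ⊠ mk (wires 1)) ⨟ mk (Z 2 1 0) =
      mk (Z 1 3 0) ⨟ (((mk triangle).transpose ⊠ mk (wires 1)) ⊠ mk triangle) ⨟ (mk (wires 2) ⊠ mk (Z 1 2 0)) ⨟ (mk (X 3 0 0) ⊠ mk (wires 1)) := by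
    rw [← hbend, seq_assoc _ (mk (X 2 1 0) ⊠ mk (wires 1)), ← seq_assoc (mk (X 2 1 0) ⊠ mk (wires 1)),
      show (mk (X 2 1 0) ⊠ mk (wires 1)) ⨟ (mk (wires 1) ⊠ mk (Z 1 2 0)) = (mk (wires 2) ⊠ mk (Z 1 2 0)) ⨟ (mk (X 2 1 0) ⊠ mk (wires 2)) from by
        rw [interchange, id_seq, seq_id, ← par_eq_seq_right],
      seq_assoc (mk (wires 2) ⊠ mk (Z 1 2 0)), show (mk (X 2 1 0) ⊠ mk (wires 2)) ⨟ (mk cap ⊠ mk (wires 1)) = mk (X 3 0 0) ⊠ mk (wires 1) from by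
        rw [← wires_par_wires 1 1, show mk (X 2 1 0) ⊠ (mk (wires 1) ⊠ mk (wires 1)) = (mk (X 2 1 0) ⊠ mk (wires 1)) ⊠ mk (wires 1) from (par_assoc' _ _ _).trans (cast_id _ _ _),
          ← seq_par_wires, hX30a],
      ← seq_assoc _ (mk (wires 2) ⊠ mk (Z 1 2 0))]
  have hTZ : ((mk triangle).transpose ⊠ mk (wires 1)) ⨟ (mk (wires 1) ⊠ mk (Z 1 2 0)) = (mk (wires 1) ⊠ mk (Z 1 2 0)) ⨟ ((mk triangle).transpose ⊠ mk (wires 2)) := by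
    rw [interchange, id_seq, seq_id, ← par_eq_seq_right]
  have h13 : mk (Z 1 2 0) ⨟ (mk (wires 1) ⊠ mk (Z 1 2 0)) = mk (Z 1 3 0) := by
    rw [Z_seq_par_Z 1 1 1 2 le_rfl, add_zero]
  have hF : mk (Z 1 2 0) ⨟ ((mk triangle).transpose ⊠ (mk (Z 1 2 0) ⨟ (mk (wires 1) ⊠ (mk triangle ⨟ mk (Z 1 2 0))) ⨟ (mk (X 2 1 0) ⊠ mk (wires 1)))) ⨟ (mk cap ⊠ mk (wires 1)) =
      mk (Z 1 3 0) ⨟ (((mk triangle).transpose ⊠ mk (wires 1)) ⊠ mk triangle) ⨟ (mk (wires 2) ⊠ mk (Z 1 2 0)) ⨟ (mk (X 3 0 0) ⊠ mk (wires 1)) := by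
    rw [par_eq_seq_left (mk triangle).transpose, wires_par_seq, wires_par_seq]
    simp only [seq_assoc]
    rw [← seq_assoc ((mk triangle).transpose ⊠ mk (wires 1)) (mk (wires 1) ⊠ mk (Z 1 2 0)), hTZ, seq_assoc (mk (wires 1) ⊠ mk (Z 1 2 0)), ← seq_assoc (mk (Z 1 2 0)) (mk (wires 1) ⊠ mk (Z 1 2 0)), h13,
      ← seq_assoc ((mk triangle).transpose ⊠ mk (wires 2)) (mk (wires 1) ⊠ (mk (wires 1) ⊠ (mk triangle ⨟ mk (Z 1 2 0)))),
      show ((mk triangle).transpose ⊠ mk (wires 2)) ⨟ (mk (wires 1) ⊠ (mk (wires 1) ⊠ (mk triangle ⨟ mk (Z 1 2 0)))) = (((mk triangle).transpose ⊠ mk (wires 1)) ⊠ mk triangle) ⨟ (mk (wires 2) ⊠ mk (Z 1 2 0)) from by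
        rw [show mk (wires 1) ⊠ (mk (wires 1) ⊠ (mk triangle ⨟ mk (Z 1 2 0))) = mk (wires 2) ⊠ (mk triangle ⨟ mk (Z 1 2 0)) from by rw [← wires_par_wires 1 1]; exact (par_assoc' _ _ _).trans (cast_id _ _ _),
          wires_par_seq, ← seq_assoc, ← wires_par_wires 1 1, show (mk triangle).transpose ⊠ (mk (wires 1) ⊠ mk (wires 1)) = ((mk triangle).transpose ⊠ mk (wires 1)) ⊠ mk (wires 1) from (par_assoc' _ _ _).trans (cast_id _ _ _),
          show (mk (wires 1) ⊠ mk (wires 1)) ⊠ mk triangle = mk (wires 1) ⊠ (mk (wires 1) ⊠ mk triangle) from (par_assoc _ _ _).trans (cast_id _ _ _),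
          show (((mk triangle).transpose ⊠ mk (wires 1)) ⊠ mk (wires 1)) ⨟ (mk (wires 1) ⊠ (mk (wires 1) ⊠ mk triangle)) = ((mk triangle).transpose ⊠ mk (wires 1)) ⊠ mk triangle from by
            rw [show mk (wires 1) ⊠ (mk (wires 1) ⊠ mk triangle) = (mk (wires 1) ⊠ mk (wires 1)) ⊠ mk triangle from (par_assoc' _ _ _).trans (cast_id _ _ _), interchange, wires_par_wires, seq_id, id_seq],
          wires_par_wires],
      show (mk (wires 1) ⊠ (mk (X 2 1 0) ⊠ mk (wires 1))) ⨟ (mk cap ⊠ mk (wires 1)) = mk (X 3 0 0) ⊠ mk (wires 1) from by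
        rw [show mk (wires 1) ⊠ (mk (X 2 1 0) ⊠ mk (wires 1)) = (mk (wires 1) ⊠ mk (X 2 1 0)) ⊠ mk (wires 1) from (par_assoc' _ _ _).trans (cast_id _ _ _), ← seq_par_wires, hX30b]]
    simp only [seq_assoc]
  -- Step 3: the mirrored fork, unbent: the two triangles in parallel between two green nodes
  have hG : mk (Z 1 2 0) ⨟ ((mk triangle).transpose ⊠ (mk (Z 1 2 0) ⨟ ((mk triangle ⨟ mk (Z 1 2 0)) ⊠ mk (wires 1)) ⨟ (mk (wires 1) ⊠ mk (X 2 1 0)))) ⨟ (mk cap ⊠ mk (wires 1)) =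
      mk (Z 1 2 0) ⨟ ((mk (Z 1 2 0) ⨟ ((mk triangle).transpose ⊠ mk triangle) ⨟ mk (Z 2 1 0)) ⊠ mk (wires 1)) ⨟ mk (X 2 1 0) := by
    rw [par_eq_seq_left (mk triangle).transpose, wires_par_seq, wires_par_seq]
    simp only [seq_assoc]
    rw [← seq_assoc ((mk triangle).transpose ⊠ mk (wires 1)) (mk (wires 1) ⊠ mk (Z 1 2 0)), hTZ, seq_assoc (mk (wires 1) ⊠ mk (Z 1 2 0)), ← seq_assoc (mk (Z 1 2 0)) (mk (wires 1) ⊠ mk (Z 1 2 0)), h13,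
      show (mk (wires 1) ⊠ (mk (wires 1) ⊠ mk (X 2 1 0))) ⨟ (mk cap ⊠ mk (wires 1)) = (mk cap ⊠ mk (wires 2)) ⨟ mk (X 2 1 0) from by
        rw [show mk (wires 1) ⊠ (mk (wires 1) ⊠ mk (X 2 1 0)) = mk (wires 2) ⊠ mk (X 2 1 0) from by rw [← wires_par_wires 1 1]; exact (par_assoc' _ _ _).trans (cast_id _ _ _),
          interchange, id_seq, seq_id, par_eq_seq_left (mk cap) (mk (X 2 1 0)), empty_par, cast_id],
      ← seq_assoc (mk (wires 1) ⊠ ((mk triangle ⨟ mk (Z 1 2 0)) ⊠ mk (wires 1))) (mk cap ⊠ mk (wires 2)) (mk (X 2 1 0)), ← seq_assoc ((mk triangle).transpose ⊠ mk (wires 2)) _ (mk (X 2 1 0)),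
      ← seq_assoc ((mk triangle).transpose ⊠ mk (wires 2)) (mk (wires 1) ⊠ ((mk triangle ⨟ mk (Z 1 2 0)) ⊠ mk (wires 1))) (mk cap ⊠ mk (wires 2)),
      show (((mk triangle).transpose ⊠ mk (wires 2)) ⨟ (mk (wires 1) ⊠ ((mk triangle ⨟ mk (Z 1 2 0)) ⊠ mk (wires 1)))) ⨟ (mk cap ⊠ mk (wires 2)) = (((mk triangle).transpose ⊠ mk triangle) ⨟ mk (Z 2 1 0)) ⊠ mk (wires 1) from by
        rw [show mk (wires 1) ⊠ ((mk triangle ⨟ mk (Z 1 2 0)) ⊠ mk (wires 1)) = (mk (wires 1) ⊠ (mk triangle ⨟ mk (Z 1 2 0))) ⊠ mk (wires 1) from (par_assoc' _ _ _).trans (cast_id _ _ _),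
          ← wires_par_wires 1 1, show (mk triangle).transpose ⊠ (mk (wires 1) ⊠ mk (wires 1)) = ((mk triangle).transpose ⊠ mk (wires 1)) ⊠ mk (wires 1) from (par_assoc' _ _ _).trans (cast_id _ _ _),
          show mk cap ⊠ (mk (wires 1) ⊠ mk (wires 1)) = (mk cap ⊠ mk (wires 1)) ⊠ mk (wires 1) from (par_assoc' _ _ _).trans (cast_id _ _ _),
          ← seq_par_wires, ← seq_par_wires, show ((mk triangle).transpose ⊠ mk (wires 1)) ⨟ (mk (wires 1) ⊠ (mk triangle ⨟ mk (Z 1 2 0))) = ((mk triangle).transpose ⊠ mk triangle) ⨟ (mk (wires 1) ⊠ mk (Z 1 2 0)) from by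
            rw [interchange, id_seq, seq_id, ← seq_id ((mk triangle).transpose), ← interchange, seq_id],
          seq_assoc, hbend],
      show mk (Z 1 3 0) = mk (Z 1 2 0) ⨟ (mk (Z 1 2 0) ⊠ mk (wires 1)) from by rw [Z_seq_Z_par 1 1 1 2 le_rfl, add_zero],
      seq_assoc, ← seq_assoc (mk (Z 1 2 0) ⊠ mk (wires 1)), ← seq_par_wires, ← seq_assoc (mk (Z 1 2 0)) ((mk triangle).transpose ⊠ mk triangle), ← seq_assoc]
  rw [h1, hM, ← hF, fork_eq_mirror, hG,
    show mk (Z 1 2 0) ⨟ ((mk triangle).transpose ⊠ mk triangle) = mk (Z 1 2 0) ⨟ (mk triangle ⊠ (mk triangle).transpose) ⨟ mk swap from by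
      rw [seq_assoc, ← swap_seq_par_one_one, ← seq_assoc, Z_seq_swap],
    seq_assoc _ (mk swap) (mk (Z 2 1 0)), swap_seq_Z, two_triangle_cycle, show mk (wires 1) ⊠ mk (wires 1) = mk (wires 2) from wires_par_wires 1 1, seq_id,
    split_seq_xmerge_eq_disconnect, sqrt_two_par_invSqrtTwo_par_one]
  where
  one_two_seq_scalar_par_two'' (A : ZXClass 1 2) (s : ZXClass 0 0) (B : ZXClass 2 2) : A ⨟ (s ⊠ B) = s ⊠ (A ⨟ B) := by
    rw [scalar_par_seq_right, empty_par, cast_id]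

/-- **JPV LICS 2019, Lemma `2-cycle-triangle-with-one-not`**:
`Z^{(1,2)} ⨾ ((X(π) ⨾ T) ⊗ Tᵗ) ⨾ Z^{(2,1)} = 1/√2 ⊗ (X^{(1,0)} ⨾ Z^{(0,1)})`. [cite: JeandelPerdrixVilmart2018, §6; JPV LICS 2019 Appendix] -/
theorem two_cycle_triangle_with_one_not :
    mk (Z 1 2 0) ⨟ ((mk (X 1 1 4) ⨟ mk triangle) ⊠ (mk triangle).transpose) ⨟ mk (Z 2 1 0) = mk invSqrtTwo ⊠ (mk (X 1 0 0) ⨟ mk (Z 0 1 0)) := by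
  have h := congrArg transpose split_triangleT_X_pi_par_triangle_merge
  simp [mk_transpose_invSqrtTwo] at h
  simpa only [seq_assoc, transpose_mk] using h

end ZXClass

end Literature.Computability.QuantumComplexity
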